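import Summits.Ventures.CertifiedManyBodySolver.Observables.SourcedGibbsTrialCapBandTwoGrid
import HarnessLib

/-!
# The AF–BCS sourced cap in momentum space (XV-h): momentum sums of band functions ODD in the gap vanish

Cell hubbard-obs (seat hubbard-obs-pin-2). HONEST FRAMING: zero compute; a symmetry lemma for the thermodynamic-limit
packaging of the certified AF–BCS cap (`AF-TL-PACKAGING.md`, step 4): the coordinate swap `k ↦ (k₂, k₁)` preserves
`ε_k` and flips `ĝ_d(k)`, so `Σ_k φ(ε_k, G_k) = 0` for every `φ` odd in `G` — in particular the anomalous-type
coefficient sums `Σ_k c₁₀` and `Σ_k c_{Q1}` of `groundEnergy_dWaveSourceTorus_le_AFBCS_kSpace` vanish identically (so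
the `U·(2k)²[n₁₀n₀₁ + s₁₀s₀₁]` term of the cap is zero). Generalises `sum_dWave_anomalous_eq_zero` (file IV).
No number is claimed; not a statement about order.

* `sum_bandFn_eq_zero_of_odd` — generic; `sum_afC10_eq_zero`, `sum_afCQ1_eq_zero` — the two AF instances.

References: Scalapino (1995) §2 [Scalapino1995]; Davis–Rabinowitz (1984) §2.1 [DavisRabinowitz1984].
-/

noncomputable section

open Real Finset Literature.MathematicalPhysics.QuantumLattice Literature.Probability.LatticeModels

namespace Summit.Ventures.CertifiedManyBodySolver.Observables

/-- **Momentum sums of band functions odd in the gap vanish**: if `φ(ε, −G) = −φ(ε, G)` then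
`Σ_k φ(ε_k, 2√2h·ĝ_d(k)) = 0` on every torus (coordinate swap). [cite: Scalapino1995, §2] -/
theorem sum_bandFn_eq_zero_of_odd (L : ℕ) [NeZero L] {φ : ℝ → ℝ → ℝ} (hφ : ∀ ε G, φ ε (-G) = -φ ε G) (h : ℝ) :
    ∑ k : TorusSite 2 L, φ (torusBand L k) (2 * Real.sqrt 2 * h * dWaveGap k) = 0 := by
  -- the coordinate swap as an involution of the momentum torus (as in `sum_dWave_anomalous_eq_zero`)
  let e : TorusSite 2 L ≃ TorusSite 2 L :=
    { toFun := fun k i => k (Equiv.swap (0 : Fin 2) 1 i)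
      invFun := fun k i => k (Equiv.swap (0 : Fin 2) 1 i)
      left_inv := fun k => by funext i; simp [Equiv.swap_apply_self]
      right_inv := fun k => by funext i; simp [Equiv.swap_apply_self] }
  have hband : ∀ k : TorusSite 2 L, torusBand L (e k) = torusBand L k := by
    intro k
    unfold torusBand latticeMomentum
    simp only [Fin.sum_univ_two, e, Equiv.coe_fn_mk, Equiv.swap_apply_left, Equiv.swap_apply_right]
    ring
  have hgap : ∀ k : TorusSite 2 L, dWaveGap (e k) = -dWaveGap k := by
    intro k
    unfold dWaveGap latticeMomentum
    simp only [e, Equiv.coe_fn_mk, Equiv.swap_apply_left, Equiv.swap_apply_right]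
    ring
  have hsum := Equiv.sum_comp e (fun k : TorusSite 2 L => φ (torusBand L k) (2 * Real.sqrt 2 * h * dWaveGap k))
  have hterm : ∀ k : TorusSite 2 L, φ (torusBand L (e k)) (2 * Real.sqrt 2 * h * dWaveGap (e k)) =
      -φ (torusBand L k) (2 * Real.sqrt 2 * h * dWaveGap k) := by
    intro k
    rw [hband k, hgap k, show 2 * Real.sqrt 2 * h * -dWaveGap k = -(2 * Real.sqrt 2 * h * dWaveGap k) by ring, hφ]
  simp only [hterm, Finset.sum_neg_distrib] at hsum
  linarith

/-- `Σ_k c₁₀(ε_k, G_k) = 0`: the `(1,0)` coefficient sum of the AF cap vanishes (odd in the gap).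
[cite: Scalapino1995, §2] -/
theorem sum_afC10_eq_zero (L : ℕ) [NeZero L] (μ' h M β : ℝ) :
    ∑ k : TorusSite 2 L, (-(2 * Real.sqrt 2 * h * dWaveGap k) * (Real.tanh (β * Real.sqrt ((Real.sqrt (torusBand L k ^ 2 + M ^ 2) + |μ'|) ^ 2 + (2 * Real.sqrt 2 * h * dWaveGap k) ^ 2) / 2) / (2 * Real.sqrt ((Real.sqrt (torusBand L k ^ 2 + M ^ 2) + |μ'|) ^ 2 + (2 * Real.sqrt 2 * h * dWaveGap k) ^ 2)) * (1 / 2 - μ' / (2 * |μ'| * Real.sqrt (torusBand L k ^ 2 + M ^ 2)) * torusBand L k) + Real.tanh (β * Real.sqrt ((Real.sqrt (torusBand L k ^ 2 + M ^ 2) - |μ'|) ^ 2 + (2 * Real.sqrt 2 * h * dWaveGap k) ^ 2) / 2) / (2 * Real.sqrt ((Real.sqrt (torusBand L k ^ 2 + M ^ 2) - |μ'|) ^ 2 + (2 * Real.sqrt 2 * h * dWaveGap k) ^ 2)) * (1 / 2 + μ' / (2 * |μ'| * Real.sqrt (torusBand L k ^ 2 + M ^ 2)) * torusBand L k))) = 0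 := by
  refine sum_bandFn_eq_zero_of_odd L (φ := fun ε G => (-G * (Real.tanh (β * Real.sqrt ((Real.sqrt (ε ^ 2 + M ^ 2) + |μ'|) ^ 2 + G ^ 2) / 2) / (2 * Real.sqrt ((Real.sqrt (ε ^ 2 + M ^ 2) + |μ'|) ^ 2 + G ^ 2)) * (1 / 2 - μ' / (2 * |μ'| * Real.sqrt (ε ^ 2 + M ^ 2)) * ε) + Real.tanh (β * Real.sqrt ((Real.sqrt (ε ^ 2 + M ^ 2) - |μ'|) ^ 2 + G ^ 2) / 2) / (2 * Real.sqrt ((Real.sqrt (ε ^ 2 + M ^ 2) - |μ'|) ^ 2 + G ^ 2)) * (1 / 2 + μ' / (2 * |μ'| * Real.sqrt (ε ^ 2 + M ^ 2)) * ε)))) (fun ε G => ?_) h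
  simp only [neg_sq]
  ring

/-- `Σ_k c_{Q1}(ε_k, G_k) = 0`: the `(3,0)` coefficient sum of the AF cap vanishes (odd in the gap).
[cite: Scalapino1995, §2] -/
theorem sum_afCQ1_eq_zero (L : ℕ) [NeZero L] (μ' h M β : ℝ) :
    ∑ k : TorusSite 2 L, (-(μ' / (2 * |μ'| * Real.sqrt (torusBand L k ^ 2 + M ^ 2))) * M * (2 * Real.sqrt 2 * h * dWaveGap k) * (Real.tanh (β * Real.sqrt ((Real.sqrt (torusBand L k ^ 2 + M ^ 2) + |μ'|) ^ 2 + (2 * Real.sqrt 2 * h * dWaveGap k) ^ 2) / 2) / (2 * Real.sqrt ((Real.sqrt (torusBand L k ^ 2 + M ^ 2) + |μ'|) ^ 2 + (2 * Real.sqrt 2 * h * dWaveGap k) ^ 2)) - Real.tanh (β * Real.sqrt ((Real.sqrt (torusBand L k ^ 2 + M ^ 2) - |μ'|) ^ 2 + (2 * Real.sqrt 2 * h * dWaveGap k) ^ 2) / 2) / (2 * Real.sqrt ((Real.sqrt (torusBand L k ^ 2 + M ^ 2) - |μ'|) ^ 2 + (2 * Real.sqrt 2 * h * dWaveGap k) ^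 2)))) = 0 := by
  refine sum_bandFn_eq_zero_of_odd L (φ := fun ε G => (-(μ' / (2 * |μ'| * Real.sqrt (ε ^ 2 + M ^ 2))) * M * G * (Real.tanh (β * Real.sqrt ((Real.sqrt (ε ^ 2 + M ^ 2) + |μ'|) ^ 2 + G ^ 2) / 2) / (2 * Real.sqrt ((Real.sqrt (ε ^ 2 + M ^ 2) + |μ'|) ^ 2 + G ^ 2)) - Real.tanh (β * Real.sqrt ((Real.sqrt (ε ^ 2 + M ^ 2) - |μ'|) ^ 2 + G ^ 2) / 2) / (2 * Real.sqrt ((Real.sqrt (ε ^ 2 + M ^ 2) - |μ'|) ^ 2 + G ^ 2))))) (fun ε G => ?_) h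
  simp only [neg_sq]
  ring

end Summit.Ventures.CertifiedManyBodySolver.Observables
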